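import Summits.PneNP.PneNP.Theorems.ChebyshevTracialDesignSpectralNonTightness
import Literature.Combinatorics.AssociationSchemes.SliceLevelInequalityWide
import HarnessLib

/-!
# Cell pnp-psdrank, route `ChebyshevTracialDesign`: spectral non-tightness on WIDER balanced slices (`n ≤ 5t`) and in the
# complement-symmetric form needed by the reduced instances of the `r = 1` rung

Harmonic backbone of the crux `TracialDecayExp20` (stmt-PneNP-19878), brick 29 (prover g8; input of S6). Brick 28
(`…SpectralNonTightness.snt_of_globalLevelD`) is SNT for `2t ≤ n ≤ 4t`. The cells of the `r = 1` rung live in REDUCED instances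
`K_{n''}`, `n'' = n − 2|S_i|`, with cut size `t'' = t − |π|` balanced only up to an additive `O(dq n)`, and possibly `2t'' > n''`
(then one passes to complements, `|δ(U) ∩ M| = |δ(Uᶜ) ∩ M|`). This file supplies exactly that form:
* §1 `ladder_ip_le_level'` — the (F1) bridge on slices `100 ≤ n ≤ 5t`, `2t ≤ n`, `16j ≤ n` (lit's `SliceLevelInequalityWide`);
* §2 `snt_wide_of_globalLevelD` — SNT for `2t ≤ n ≤ 5t` (the proof of brick 28 verbatim with the wide bridge; head levels `2κ ≤ 2(dq n+8) ≤ n/16`);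
* §3 `cc_compl` (`cc` is complement-invariant) and **`snt_sym_oddSet_of_globalLevelD`** — for even `n ≥ n₁`, odd `t` with `n ≤ 5t` and
  `n ≤ 5(n−t)` (no `2t ≤ n` needed), `X` a family of `t`-cuts and `Y` a `(PM_n,τ)`-homogeneous set of perfect matchings, both of density
  `≥ exp(−c₀·dq n)`: some `(U,M) ∈ X × Y` has `cc U M = 1`.
[cite: KeevashLifshitz2023, Thm. 1.8] [cite: KupavskiiZakharov2022, §2] [cite: Rothvoss2017, §2 (PDF p. 6)] [cite: ODonnell2014, §9.5]
Stature: support/instrument, CONDITIONAL on the named fact `GlobalLevelDInequality`. WHAT THIS IS NOT: not the r = 1 rung, nothing on psd rank,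
no P-vs-NP content. Supports stmt-PneNP-19878.
-/

set_option linter.dupNamespace false -- `Summit.PneNP.PneNP.…`: summit = sub-problem (D-0017)

noncomputable section

namespace Summit.PneNP.PneNP.Theorems.ChebyshevTracialDesignSpectralNonTightnessWide

open Finset Literature.Barriers.PneNP Literature.Combinatorics.Optimization
open Literature.Combinatorics.AssociationSchemes Literature.Combinatorics.AssociationSchemes.JohnsonHarmonics
open Literature.Combinatorics.AssociationSchemes.JohnsonSpectrum
open Literature.Combinatorics.AssociationSchemes.HomogeneousMatchingFamilies
open Literature.Combinatorics.AssociationSchemes.SliceLevelInequality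
open Literature.Combinatorics.SetFamily
open Literature.Combinatorics.SimpleGraph.CycleSpace
open Literature.Combinatorics.Additive.KeevashLifshitz
open Summit.PneNP.PneNP.Theorems.ChebyshevTracialDesignTightFreeSpectral
open Summit.PneNP.PneNP.Theorems.ChebyshevTracialDesignTightColumnSums
open Summit.PneNP.PneNP.Theorems.ChebyshevTracialDesignLevelTail
open Summit.PneNP.PneNP.Theorems.ChebyshevTracialDesignProfilePolynomial
open Summit.PneNP.PneNP.Theorems.ChebyshevTracialDesignProfileExtrapolation
open Summit.PneNP.PneNP.Theorems.ChebyshevTracialDesignSpectralNonTightnessLayers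
open Summit.PneNP.PneNP.Theorems.ChebyshevTracialDesignSpectralNonTightnessEstimates
open Summit.PneNP.PneNP.Theorems.ChebyshevTracialDesignSpectralNonTightness

variable {n : ℕ}

/-! ### §1 The (F1) bridge on wider balanced slices -/

/-- **The (F1) bridge, wide balance**: on a slice with `100 ≤ n ≤ 5t`, `2t ≤ n` and for `1 ≤ j ≤ n/16`, the ladder norm of the degree-`j` layer of
`1_X` obeys `⟪(Wᵀ)^{t−j}p_j, (Wᵀ)^{t−j}p_j⟫ ≤ 16·C(n,t)·μ²·(48e(2 ln(1/μ)/j + 3))^j`, `μ = |X|/C(n,t)` — lit's PROVED slice level-`j`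
inequality `slice_layer_sq_le_log_balanced'` for the rescaled coefficient vectors `(t−i)!·p_i` (`((Wᵀ)^{t−i}p_i)(U) = (t−i)!·zeta p_i (U)`).
[cite: ODonnell2014, §9.5] -/
theorem ladder_ip_le_level' {t j : ℕ} (hn : 100 ≤ n) (hbal : n ≤ 5 * t) (h2t : 2 * t ≤ n) (hj1 : 1 ≤ j) (hj : 16 * j ≤ n)
    (X : Finset (Finset (Fin n))) (hX : X ⊆ univ.powersetCard t)
    (p : ℕ → Finset (Fin n) → ℝ) (hp : ∀ j, IsHarmonic j (p j))
    (hdec : ∀ U ∈ univ.powersetCard t, (if U ∈ X then (1 : ℝ) else 0) = (∑ j ∈ range (t + 1), up^[t - j] (p j)) U) :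
    ip (up^[t - j] (p j)) (up^[t - j] (p j)) ≤
      16 * (n.choose t : ℝ) * ((X.card : ℝ) / (n.choose t : ℝ)) ^ 2 *
        (48 * (Real.exp 1 * (2 * Real.log (1 / ((X.card : ℝ) / (n.choose t : ℝ))) / j + 3))) ^ j := by
  have hjt : j ≤ t := by omega
  set q : ℕ → Finset (Fin n) → ℝ := fun i => ((t - i).factorial : ℝ) • p i with hq
  have hq' : ∀ i, IsHarmonic i (q i) := fun i => (hp i).smul _
  set f : Finset (Fin n) → ℝ := fun U => if U ∈ X then (1 : ℝ) else 0 with hf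
  have hf0 : ∀ U : Finset (Fin n), U.card = t → 0 ≤ f U := fun U _ => by
    simp only [hf]; split_ifs <;> norm_num
  have hf1 : ∀ U : Finset (Fin n), U.card = t → f U ≤ 1 := fun U _ => by
    simp only [hf]; split_ifs <;> norm_num
  have hdec' : ∀ U ∈ powersetCard t (univ : Finset (Fin n)), f U = ∑ i ∈ range (t + 1), zeta (q i) U := by
    intro U hU
    have hUt : U.card = t := (mem_powersetCard.1 hU).2
    have h0 := hdec U hU
    simp only [hf]
    rw [h0, Finset.sum_apply]
    refine sum_congr rfl fun i hi => ?_
    have hit : i ≤ t := by have := mem_range.1 hi; omega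
    rw [ladder_apply_eq_factorial_mul_zeta hit (hp i).1 hUt]
    simp only [hq, map_smul, Pi.smul_apply, smul_eq_mul]
  have hmean : sliceMean n t f = (X.card : ℝ) / (n.choose t : ℝ) := sliceMean_indicator X hX
  have key := slice_layer_sq_le_log_balanced' hn hbal h2t hj1 hj q hq' f hf0 hf1 hdec'
  rw [hmean] at key
  have hhom : IsHomog t (up^[t - j] (p j)) := by
    have := isHomog_iterate_up (hp j).1 (t - j); rwa [Nat.add_sub_cancel' hjt] at this
  have hL : ip (up^[t - j] (p j)) (up^[t - j] (p j)) = ∑ U ∈ powersetCard t univ, zeta (q j) U ^ 2 := by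
    rw [← sum_powersetCard_mul_of_isHomog _ hhom]
    refine sum_congr rfl fun U hU => ?_
    have hUt : U.card = t := (mem_powersetCard.1 hU).2
    rw [ladder_apply_eq_factorial_mul_zeta hjt (hp j).1 hUt]
    simp only [hq, map_smul, Pi.smul_apply, smul_eq_mul, sq]
  rw [hL]
  exact key

/-! ### §2 Spectral non-tightness for `2t ≤ n ≤ 5t` -/

/-- **SPECTRAL NON-TIGHTNESS, wide balance (modulo Keevash–Lifshitz Thm 1.8).** Assume `GlobalLevelDInequality`. For every `τ ≥ 1`
there are `c₀ > 0` and `n₁` such that: for all even `n ≥ n₁`, all `t = 2c'+1` with `2t ≤ n ≤ 5t`, every family `X` of `t`-subsets of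
`Fin n` with `|X|/C(n,t) ≥ exp(−c₀·dq n)`, and every set `Y` of perfect matchings of `K_n` whose edge sets are `(PM_n, τ)`-homogeneous with
`|Y|/|PM_n| ≥ exp(−c₀·dq n)`, some pair `(U, M) ∈ X × Y` is TIGHT (`U` contains exactly one vertex whose `M`-partner lies outside `U`,
i.e. `|δ(U) ∩ M| = 1`). Planner p1's SNT lemma (N2-SpreadStructure §SNT (1)) at the exp scale `ℓ = c₀·dq n ≍ n^{1/4}`; the dense
spread cells of the `r = 1` rung are therefore empty. [cite: KeevashLifshitz2023, Thm. 1.8] [cite: KupavskiiZakharov2022, §2]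
[cite: Rothvoss2017, §2 (PDF p. 6)] [cite: ODonnell2014, §9.5] -/
theorem snt_wide_of_globalLevelD (hKL : GlobalLevelDInequality) {τ : ℝ} (hτ : 1 ≤ τ) :
    ∃ c₀ : ℝ, 0 < c₀ ∧ ∃ n₁ : ℕ, ∀ (n c' : ℕ), n₁ ≤ n → Even n → 2 * (2 * c' + 1) ≤ n → n ≤ 5 * (2 * c' + 1) →
      ∀ (X : Finset (Finset (Fin n))), X ⊆ univ.powersetCard (2 * c' + 1) →
      ∀ (Y : Finset (PMatch n)), IsRelHomogeneous τ (perfectMatchings (univ : Finset (Fin n))) (Y.image Subtype.val) →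
      Real.exp (-(c₀ * dq n)) ≤ (X.card : ℝ) / (n.choose (2 * c' + 1) : ℝ) →
      Real.exp (-(c₀ * dq n)) ≤ (Y.card : ℝ) / (Fintype.card (PMatch n) : ℝ) →
      ∃ U ∈ X, ∃ M ∈ Y, (U.filter fun x => M.2.partner x ∉ U).card = 1 := by
  obtain ⟨C, hC, hKLb⟩ := abs_layerCorr_even_le_KL hKL
  have hτ0 : 0 < τ := one_pos.trans_le hτ
  have hc₁pos : 0 < 1 / (2736 * C * τ ^ 2) := by positivity
  refine ⟨min 1 (1 / (2736 * C * τ ^ 2)), lt_min one_pos hc₁pos, (2 * 10 ^ 8) ^ 4, ?_⟩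
  intro n c' hn₁ hn ht hbal X hX Y hhom hμ hν
  have hc₀0 : 0 < min 1 (1 / (2736 * C * τ ^ 2)) := lt_min one_pos hc₁pos
  have hc₀1 : min 1 (1 / (2736 * C * τ ^ 2)) ≤ 1 := min_le_left _ _
  have hc₀C : min 1 (1 / (2736 * C * τ ^ 2)) ≤ 1 / (2736 * C * τ ^ 2) := min_le_right _ _
  -- the size parameter `D = dq n ≥ 2·10⁸`, `D⁴ ≤ n`
  have hD : 2 * 10 ^ 8 ≤ dq n := by
    unfold dq
    rw [Nat.le_sqrt, Nat.le_sqrt]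
    calc 2 * 10 ^ 8 * (2 * 10 ^ 8) * (2 * 10 ^ 8 * (2 * 10 ^ 8)) = (2 * 10 ^ 8) ^ 4 := by norm_num
      _ ≤ n := hn₁
  have hD4n : dq n ^ 4 ≤ n := by
    have h1 : dq n * dq n ≤ Nat.sqrt n := Nat.sqrt_le (Nat.sqrt n)
    calc dq n ^ 4 = (dq n * dq n) * (dq n * dq n) := by ring
      _ ≤ Nat.sqrt n * Nat.sqrt n := Nat.mul_le_mul h1 h1
      _ ≤ n := Nat.sqrt_le n
  have hD2 : dq n * dq n ≤ dq n ^ 4 := by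
    calc dq n * dq n = dq n * dq n * 1 := (mul_one _).symm
      _ ≤ dq n * dq n * (dq n * dq n) := Nat.mul_le_mul_left _ (Nat.one_le_iff_ne_zero.2 (by positivity))
      _ = dq n ^ 4 := by ring
  have h100 : 100 ≤ n := by
    have : 100 ≤ dq n * dq n := by nlinarith
    omega
  have h32 : 32 * (dq n + 8) ≤ n := by
    have : 32 * (dq n + 8) ≤ dq n * dq n := by nlinarith
    omega
  by_contra hcon
  push Not at hcon
  -- the harmonic layer decomposition of `1_X` and the Gram class function of the tight incidence
  have hhomog : IsHomog (2 * c' + 1) (fun U : Finset (Fin n) => if U ∈ X then (1 : ℝ) else 0) := by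
    intro S hS
    simp only
    rw [if_neg]
    intro hSX
    exact hS (mem_powersetCard.1 (hX hSX)).2
  obtain ⟨p, hp, hpeq⟩ := exists_ladder_decomposition (by omega : 2 * (2 * c' + 1) ≤ n + 1) hhomog
  have hdec : ∀ U ∈ univ.powersetCard (2 * c' + 1),
      (if U ∈ X then (1 : ℝ) else 0) = (∑ j ∈ range (2 * c' + 1 + 1), up^[2 * c' + 1 - j] (p j)) U :=
    fun U _ => congrFun hpeq U
  obtain ⟨κ₁, hA1⟩ := exists_tightGram_classFunction (n := n) (t := 2 * c' + 1) ⟨c', rfl⟩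
  -- densities
  have hPMpos : (0 : ℝ) < Fintype.card (PMatch n) := by exact_mod_cast card_pmatch_pos hn
  have hCnpos : (0 : ℝ) < (n.choose (2 * c' + 1) : ℝ) := by exact_mod_cast Nat.choose_pos (by omega)
  have hN1pos : (0 : ℝ) < ((((n / 2).choose (1 + c') * (1 + c').choose c' * 2 ^ 1 : ℕ) : ℝ)) := by
    have h1 : 0 < (n / 2).choose (1 + c') := Nat.choose_pos (by omega)
    have h2 : 0 < (1 + c').choose c' := Nat.choose_pos (by omega)
    positivity
  have hμ1 : (X.card : ℝ) / (n.choose (2 * c' + 1) : ℝ) ≤ 1 := by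
    rw [div_le_one hCnpos]
    have := card_le_card hX
    rw [card_powersetCard, card_univ, Fintype.card_fin] at this
    exact_mod_cast this
  have hν1 : (Y.card : ℝ) / (Fintype.card (PMatch n) : ℝ) ≤ 1 := by
    rw [div_le_one hPMpos]
    exact_mod_cast (card_le_univ Y).trans_eq Finset.card_univ
  have hμ0 : 0 < (X.card : ℝ) / (n.choose (2 * c' + 1) : ℝ) := (Real.exp_pos _).trans_le hμ
  have hν0 : 0 < (Y.card : ℝ) / (Fintype.card (PMatch n) : ℝ) := (Real.exp_pos _).trans_le hν
  -- the normalised tightness identity, split into head and tail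
  have hid := density_mul_density_le_sum_abs hn ht X hX Y p hp hdec hcon
  rw [← sum_filter_add_sum_filter_not (Icc 1 c') (fun κ => κ ≤ dq n + 8)] at hid
  -- HEAD
  have hhead : ∀ κ ∈ (Icc 1 c').filter (fun κ => κ ≤ dq n + 8),
      |∑ M ∈ Y, ∑ U ∈ univ.powersetCard (2 * c' + 1),
          (up^[2 * c' + 1 - 2 * κ] (p (2 * κ))) U * (if (U.filter fun x => M.2.partner x ∉ U).card = 1 then (1 : ℝ) else 0)| /
          ((Fintype.card (PMatch n) : ℝ) * ((((n / 2).choose (1 + c') * (1 + c').choose c' * 2 ^ 1 : ℕ) : ℝ))) ≤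
        4 * ((X.card : ℝ) / (n.choose (2 * c' + 1) : ℝ)) * ((Y.card : ℝ) / (Fintype.card (PMatch n) : ℝ)) * (1 / 16) ^ κ := by
    intro κ hκ
    obtain ⟨hκI, hκD⟩ := mem_filter.1 hκ
    obtain ⟨hκ1, hκc⟩ := mem_Icc.1 hκI
    have h4κn : 4 * κ ≤ n := by omega
    have h32κn : 16 * (2 * κ) ≤ n := by omega
    have hL := ladder_ip_le_level' (t := 2 * c' + 1) (j := 2 * κ) h100 hbal (by omega) (by omega) h32κn X hX p hp hdec
    have hLq : ip (up^[2 * c' + 1 - 2 * κ] (p (2 * κ))) (up^[2 * c' + 1 - 2 * κ] (p (2 * κ))) / (n.choose (2 * c' + 1) : ℝ) ≤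
        16 * ((X.card : ℝ) / (n.choose (2 * c' + 1) : ℝ)) ^ 2 *
          (48 * (Real.exp 1 * (2 * Real.log (1 / ((X.card : ℝ) / (n.choose (2 * c' + 1) : ℝ))) / ((2 * κ : ℕ) : ℝ) + 3))) ^
            (2 * κ) := by
      rw [div_le_iff₀ hCnpos]
      calc ip (up^[2 * c' + 1 - 2 * κ] (p (2 * κ))) (up^[2 * c' + 1 - 2 * κ] (p (2 * κ)))
          ≤ 16 * (n.choose (2 * c' + 1) : ℝ) * ((X.card : ℝ) / (n.choose (2 * c' + 1) : ℝ)) ^ 2 *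
            (48 * (Real.exp 1 * (2 * Real.log (1 / ((X.card : ℝ) / (n.choose (2 * c' + 1) : ℝ))) / ((2 * κ : ℕ) : ℝ) + 3))) ^
              (2 * κ) := hL
        _ = 16 * ((X.card : ℝ) / (n.choose (2 * c' + 1) : ℝ)) ^ 2 *
            (48 * (Real.exp 1 * (2 * Real.log (1 / ((X.card : ℝ) / (n.choose (2 * c' + 1) : ℝ))) / ((2 * κ : ℕ) : ℝ) + 3))) ^
              (2 * κ) * (n.choose (2 * c' + 1) : ℝ) := by ring
    exact head_term_abstract hC hτ hc₀0 hc₀1 hc₀C hD hD4n hκ1 hκD (mul_pos hPMpos hN1pos) (atten_le_pow h4κn)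
      (div_nonneg (ip_self_nonneg _) hCnpos.le) hLq hμ hμ1 hν hν1
      (fun h8 h5 => hKLb n c' κ hn ht hκ1 hκc Y τ hτ hhom h8 h5 p hp κ₁ hA1)
      (abs_layerCorr_even_le_parseval hn ht hκc Y p hp κ₁ hA1)
  have hheadsum : ∑ κ ∈ (Icc 1 c').filter (fun κ => κ ≤ dq n + 8),
      |∑ M ∈ Y, ∑ U ∈ univ.powersetCard (2 * c' + 1),
          (up^[2 * c' + 1 - 2 * κ] (p (2 * κ))) U * (if (U.filter fun x => M.2.partner x ∉ U).card = 1 then (1 : ℝ) else 0)| /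
          ((Fintype.card (PMatch n) : ℝ) * ((((n / 2).choose (1 + c') * (1 + c').choose c' * 2 ^ 1 : ℕ) : ℝ))) ≤
        4 * ((X.card : ℝ) / (n.choose (2 * c' + 1) : ℝ)) * ((Y.card : ℝ) / (Fintype.card (PMatch n) : ℝ)) * (1 / 15) := by
    refine (sum_le_sum hhead).trans ?_
    rw [← mul_sum]
    refine mul_le_mul_of_nonneg_left ?_ (by positivity)
    have hsub : (Icc 1 c').filter (fun κ => κ ≤ dq n + 8) ⊆ Ico 1 (dq n + 9) := by
      intro κ hκ
      obtain ⟨hκI, hκD⟩ := mem_filter.1 hκ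
      rw [mem_Ico]; have := (mem_Icc.1 hκI).1; omega
    calc ∑ κ ∈ (Icc 1 c').filter (fun κ => κ ≤ dq n + 8), ((1 : ℝ) / 16) ^ κ
        ≤ ∑ κ ∈ Ico 1 (dq n + 9), ((1 : ℝ) / 16) ^ κ :=
          sum_le_sum_of_subset_of_nonneg hsub fun κ _ _ => by positivity
      _ ≤ ((1 : ℝ) / 16) ^ 1 / (1 - 1 / 16) := geom_sum_Ico_le_of_lt_one (by norm_num) (by norm_num)
      _ = 1 / 15 := by norm_num
  -- TAIL
  have htail : ∀ κ ∈ (Icc 1 c').filter (fun κ => ¬κ ≤ dq n + 8),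
      |∑ M ∈ Y, ∑ U ∈ univ.powersetCard (2 * c' + 1),
          (up^[2 * c' + 1 - 2 * κ] (p (2 * κ))) U * (if (U.filter fun x => M.2.partner x ∉ U).card = 1 then (1 : ℝ) else 0)| /
          ((Fintype.card (PMatch n) : ℝ) * ((((n / 2).choose (1 + c') * (1 + c').choose c' * 2 ^ 1 : ℕ) : ℝ))) ≤
        Real.sqrt (((X.card : ℝ) / (n.choose (2 * c' + 1) : ℝ)) * ((Y.card : ℝ) / (Fintype.card (PMatch n) : ℝ)) *
          ∏ i ∈ range (dq n + 9), ((2 * i + 1 : ℝ) / ((n : ℝ) - 2 * i))) := by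
    intro κ hκ
    obtain ⟨hκI, hκD⟩ := mem_filter.1 hκ
    obtain ⟨hκ1, hκc⟩ := mem_Icc.1 hκI
    exact tail_term_le hn ht hκc (by omega) X hX Y p hp hdec κ₁ hA1
  have htailsum : ∑ κ ∈ (Icc 1 c').filter (fun κ => ¬κ ≤ dq n + 8),
      |∑ M ∈ Y, ∑ U ∈ univ.powersetCard (2 * c' + 1),
          (up^[2 * c' + 1 - 2 * κ] (p (2 * κ))) U * (if (U.filter fun x => M.2.partner x ∉ U).card = 1 then (1 : ℝ) else 0)| /
          ((Fintype.card (PMatch n) : ℝ) * ((((n / 2).choose (1 + c') * (1 + c').choose c' * 2 ^ 1 : ℕ) : ℝ))) ≤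
        ((X.card : ℝ) / (n.choose (2 * c' + 1) : ℝ)) * ((Y.card : ℝ) / (Fintype.card (PMatch n) : ℝ)) / 4 := by
    refine (sum_le_sum htail).trans ?_
    rw [sum_const, nsmul_eq_mul]
    have hcard : (((Icc 1 c').filter (fun κ => ¬κ ≤ dq n + 8)).card : ℝ) ≤ c' := by
      have h := card_filter_le (Icc 1 c') (fun κ => ¬κ ≤ dq n + 8)
      rw [Nat.card_Icc] at h
      exact_mod_cast (h.trans (by omega))
    calc (((Icc 1 c').filter (fun κ => ¬κ ≤ dq n + 8)).card : ℝ) *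
          Real.sqrt (((X.card : ℝ) / (n.choose (2 * c' + 1) : ℝ)) * ((Y.card : ℝ) / (Fintype.card (PMatch n) : ℝ)) *
            ∏ i ∈ range (dq n + 9), ((2 * i + 1 : ℝ) / ((n : ℝ) - 2 * i)))
        ≤ (c' : ℝ) * Real.sqrt (((X.card : ℝ) / (n.choose (2 * c' + 1) : ℝ)) * ((Y.card : ℝ) / (Fintype.card (PMatch n) : ℝ)) *
            ∏ i ∈ range (dq n + 9), ((2 * i + 1 : ℝ) / ((n : ℝ) - 2 * i))) :=
          mul_le_mul_of_nonneg_right hcard (Real.sqrt_nonneg _)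
      _ ≤ _ := tail_sum_arith (by omega) ht hc₀1 hμ hν
  -- contradiction
  have hμν : 0 < ((X.card : ℝ) / (n.choose (2 * c' + 1) : ℝ)) * ((Y.card : ℝ) / (Fintype.card (PMatch n) : ℝ)) :=
    mul_pos hμ0 hν0
  linarith

/-! ### §3 Complement symmetry and the form used by the reduced instances -/

/-- A pair crosses `univ ∖ A` iff it crosses `A`. [cite: Rothvoss2017, §2 (PDF p. 5: `δ(U) = δ(V ∖ U)`)] -/
theorem crosses_univ_sdiff_iff (A : Finset (Fin n)) (e : Sym2 (Fin n)) : Crosses (univ \ A) e ↔ Crosses A e := by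
  induction e using Sym2.ind with
  | h x y =>
    simp only [crosses_mk, mem_sdiff, mem_univ, true_and, not_not]
    tauto

/-- `cc` is complement-invariant: `|δ(V ∖ U) ∩ M| = |δ(U) ∩ M|`. [cite: Rothvoss2017, §2 (PDF p. 5)] -/
theorem cc_compl (U : OddSet n) (hc : Odd (univ \ U.1).card) (M : PMatch n) : cc ⟨univ \ U.1, hc⟩ M = cc U M := by
  unfold cc
  congr 1
  exact filter_congr fun e _ => crosses_univ_sdiff_iff U.1 e

/-- **SNT, complement-symmetric form in the route's currency** (modulo `GlobalLevelDInequality`). For every `τ ≥ 1` there are `c₀ > 0`, `n₁`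
with: for even `n ≥ n₁`, odd `t` with `n ≤ 5t` and `n ≤ 5(n − t)`, every family `X` of `t`-cuts (`X : Finset (OddSet n)`) with
`|X|/C(n,t) ≥ exp(−c₀·dq n)` and every set `Y` of perfect matchings with `(PM_n, τ)`-homogeneous edge sets and `|Y|/|PM_n| ≥ exp(−c₀·dq n)`,
some `(U, M) ∈ X × Y` has `cc U M = 1`. (If `2t ≤ n` this is §2; otherwise pass to the complements `V ∖ U`, of size `n − t ≤ n/2`, which have the same
density and the same crossing counts.) [cite: KeevashLifshitz2023, Thm. 1.8] [cite: KupavskiiZakharov2022, §2] [cite: Rothvoss2017, §2 (PDF pp. 5–6)] -/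
theorem snt_sym_oddSet_of_globalLevelD (hKL : GlobalLevelDInequality) {τ : ℝ} (hτ : 1 ≤ τ) :
    ∃ c₀ : ℝ, 0 < c₀ ∧ ∃ n₁ : ℕ, ∀ (n t : ℕ), n₁ ≤ n → Even n → Odd t → n ≤ 5 * t → n ≤ 5 * (n - t) →
      ∀ (X : Finset (OddSet n)), (∀ U ∈ X, U.1.card = t) →
      ∀ (Y : Finset (PMatch n)), IsRelHomogeneous τ (perfectMatchings (univ : Finset (Fin n))) (Y.image Subtype.val) →
      Real.exp (-(c₀ * dq n)) ≤ (X.card : ℝ) / (n.choose t : ℝ) →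
      Real.exp (-(c₀ * dq n)) ≤ (Y.card : ℝ) / (Fintype.card (PMatch n) : ℝ) →
      ∃ U ∈ X, ∃ M ∈ Y, cc U M = 1 := by
  obtain ⟨c₀, hc₀, n₁, h⟩ := snt_wide_of_globalLevelD hKL hτ
  refine ⟨c₀, hc₀, n₁, fun n t hn₁ hn hto h5 h5' X hXt Y hhom hμ hν => ?_⟩
  -- `X` is nonempty, so `t ≤ n`
  have hXne : X.Nonempty := by
    rw [nonempty_iff_ne_empty]
    rintro rfl
    have := (Real.exp_pos (-(c₀ * dq n))).trans_le hμ
    simp at this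
  obtain ⟨U₀, hU₀⟩ := hXne
  have htn : t ≤ n := by
    have := card_le_univ U₀.1
    rw [Fintype.card_fin, hXt U₀ hU₀] at this
    exact this
  obtain ⟨c', rfl⟩ := hto
  by_cases h2t : 2 * (2 * c' + 1) ≤ n
  · -- the direct case
    have hX' : X.image Subtype.val ⊆ univ.powersetCard (2 * c' + 1) := by
      intro U hU
      obtain ⟨U', hU', rfl⟩ := mem_image.1 hU
      exact mem_powersetCard_univ.2 (hXt U' hU')
    have hcard : ((X.image Subtype.val).card : ℝ) = X.card := by
      rw [card_image_of_injective _ Subtype.val_injective]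
    obtain ⟨U, hU, M, hM, hUM⟩ := h n c' hn₁ hn h2t h5 (X.image Subtype.val) hX' Y hhom (by rw [hcard]; exact hμ) hν
    obtain ⟨U', hU', rfl⟩ := mem_image.1 hU
    exact ⟨U', hU', M, hM, by rw [cc_eq_card_filter_partner]; exact hUM⟩
  · -- pass to complements: `|V ∖ U| = n − t = 2c''+1` with `2(n−t) ≤ n ≤ 5(n−t)`
    obtain ⟨m, hm⟩ := hn
    obtain ⟨c'', hc''⟩ : ∃ c'' : ℕ, n - (2 * c' + 1) = 2 * c'' + 1 := ⟨(n - (2 * c' + 1)) / 2, by omega⟩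
    have h2t' : 2 * (2 * c'' + 1) ≤ n := by omega
    have h5'' : n ≤ 5 * (2 * c'' + 1) := by rw [← hc'']; exact h5'
    set X' : Finset (Finset (Fin n)) := X.image (fun U => univ \ U.1) with hX'def
    have hX' : X' ⊆ univ.powersetCard (2 * c'' + 1) := by
      intro V hV
      obtain ⟨U, hU, rfl⟩ := mem_image.1 hV
      rw [mem_powersetCard_univ, card_univ_sdiff, Fintype.card_fin, hXt U hU, hc'']
    have hinj : Set.InjOn (fun U : OddSet n => univ \ U.1) ↑X := by
      intro U _ V _ hUV
      apply Subtype.ext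
      have := congrArg (fun W : Finset (Fin n) => univ \ W) hUV
      simpa [Finset.sdiff_sdiff_eq_self (subset_univ _)] using this
    have hcard : (X'.card : ℝ) = X.card := by rw [hX'def, card_image_of_injOn hinj]
    have hchoose : (n.choose (2 * c'' + 1) : ℝ) = n.choose (2 * c' + 1) := by
      rw [← hc'', Nat.choose_symm htn]
    obtain ⟨V, hV, M, hM, hVM⟩ := h n c'' hn₁ ⟨m, hm⟩ h2t' h5'' X' hX' Y hhom (by rw [hcard, hchoose]; exact hμ) hν
    obtain ⟨U, hU, rfl⟩ := mem_image.1 hV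
    have hodd : Odd (univ \ U.1).card := by
      rw [card_univ_sdiff, Fintype.card_fin, hXt U hU, hc'']; exact ⟨c'', rfl⟩
    refine ⟨U, hU, M, hM, ?_⟩
    rw [← cc_compl U hodd M, cc_eq_card_filter_partner]
    exact hVM

end Summit.PneNP.PneNP.Theorems.ChebyshevTracialDesignSpectralNonTightnessWide
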